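import Summits.Ventures.HodgeRepro2.T5LandherrInvariants

/-!
# The invariants `(n, {σ_v}, d₀)` ARE invariants: Shimura's Theorem 2.2 (i) as an `iff`, modulo the Hasse principle
(cell pub-hodge-repro2, seat p3)

Tier-5 N2 support, rows N2.2.7 / N2.2.9 / N2.8.1 of route/T5-N2-route-3.md; the necessity half of file 161. File
161 derives Shimura's «the isomorphism class of (V, ϕ) is determined by n, {σ_v}, and d₀(ϕ)» (Doc. Math. 13 (2008)
Thm 2.2 (i)) from the Hasse principle: same determinant class and same signatures ⇒ congruent. The unstated
converse — that `d₀` and the signatures are invariants of the isomorphism class — is kernel with no display at all: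
* `exists_det_eq_mul_norm_of_isCongruent`: congruent Gram matrices have determinants in the same class
  `F^×/N_{K/F}(K^×)` (`det H' = z · star z · det H`, `z = det P`; file 134's `IsCongruent.exists_det_eq`);
* `posDef_of_isCongruent`, `posDef_diagonal_two_iff`, **`sign_add_eq_of_isCongruent`**: over `ℂ`, congruent
  diagonal matrices `diag(a', b')`, `diag(a, b)` with non-zero real entries have equal sign sums — the determinant
  decides whether the signs agree or differ, and positive definiteness (Mathlib's `PosDef`, transported along the
  congruence) decides between `(+, +)` and `(−, −)`; Sylvester's law of inertia in rank 2, without the inertia files;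
* `isCongruent_map_of_isCongruent`, `sign_add_eq_of_isCongruent_map`: congruence over `K` gives congruence over
  `ℂ` under every embedding (`star ↦ conj`), hence equal sign sums at every `φ : K → ℂ`;
* **`exists_isometry_pairForm_iff`** — THEOREM 2.2 (i) AS AN `iff` on the rank-2 diagonal forms `pairForm c₁ c₂`
  (seat t6-p5's shape): an isometry exists iff `c₁ c₂ ≡ c₁' c₂'` modulo norms AND the sign sums agree under every
  embedding — `⇐` by file 161's display implication (the Hasse principle `GrossBH2021_Thm3_1_uniqueness K (Fin 2)`,
  the only non-kernel input), `⇒` by the two necessity lemmas; and **`isCongruent_iff_invariants`**, the same in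
  Gram form for any size `n` (`IsCongruent H H' ↔` same determinant class ∧ congruent under every `φ`).

Mathlib + files 134 / 156 / 157 / 158 / 161 and their imports; no new display; no device. §8(d): uses an
L-value-free non-vanishing device: NO.
-/

namespace Summit.Ventures.HodgeRepro2.T5LandherrInvariantsIff

open Matrix NumberField NumberField.IsCMField
open scoped ComplexOrder
open Summit.Ventures.HodgeRepro2.T5HermitianDetClass Summit.Ventures.HodgeRepro2.T5HermitianGlobalChain
  Summit.Ventures.HodgeRepro2.T5GramIsometry Summit.Ventures.HodgeRepro2.T5GramSignature
  Summit.Ventures.HodgeRepro2.T5LandherrInvariants Summit.Ventures.HodgeRepro2.T5DatumSimilitude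
  Summit.Ventures.HodgeRepro2.T5FinitePlaceSplitClassification

/-! ## Necessity over `ℂ`: the sign sum is a congruence invariant (rank 2) -/

section Complex

/-- Positive definiteness transports along a congruence (`H' = Pᴴ H P`, `P` invertible). -/
theorem posDef_of_isCongruent {n : Type*} [Fintype n] [DecidableEq n] {H H' : Matrix n n ℂ}
    (h : IsCongruent H H') (hH : H.PosDef) : H'.PosDef := by
  obtain ⟨P, hP, rfl⟩ := h
  exact hH.conjTranspose_mul_mul_same (mulVec_injective_iff_isUnit.mpr ((isUnit_iff_isUnit_det P).mpr hP))

/-- `diag(a, b)` over `ℂ` with real entries is positive definite iff `a > 0` and `b > 0`. -/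
theorem posDef_diagonal_two_iff (a b : ℝ) :
    (diagonal ![(a : ℂ), (b : ℂ)]).PosDef ↔ 0 < a ∧ 0 < b := by
  rw [posDef_diagonal_iff]
  constructor
  · intro h
    exact ⟨Complex.zero_lt_real.mp (by simpa using h 0), Complex.zero_lt_real.mp (by simpa using h 1)⟩
  · rintro ⟨ha, hb⟩ i
    fin_cases i
    · exact Complex.zero_lt_real.mpr ha
    · exact Complex.zero_lt_real.mpr hb

/-- **Congruent ⇒ equal sign sums** (rank 2, non-zero real entries): the determinant class fixes the product of the
signs, positive definiteness separates `(+, +)` from `(−, −)`. -/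
theorem sign_add_eq_of_isCongruent {a b a' b' : ℝ} (ha : a ≠ 0) (hb : b ≠ 0) (ha' : a' ≠ 0) (hb' : b' ≠ 0)
    (h : IsCongruent (diagonal ![(a' : ℂ), (b' : ℂ)]) (diagonal ![(a : ℂ), (b : ℂ)])) :
    (SignType.sign a : ℤ) + SignType.sign b = (SignType.sign a' : ℤ) + SignType.sign b' := by
  -- the determinant class: `a b = |u|² a' b'`
  obtain ⟨u, hu, hdet⟩ := h.exists_det_eq
  rw [det_diagonal, det_diagonal, Fin.prod_univ_two, Fin.prod_univ_two] at hdet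
  simp only [Matrix.cons_val_zero, Matrix.cons_val_one] at hdet
  rw [Complex.star_def, ← Complex.normSq_eq_conj_mul_self] at hdet
  have ht : 0 < Complex.normSq u := Complex.normSq_pos.mpr hu.ne_zero
  have hP : a * b = Complex.normSq u * (a' * b') := by exact_mod_cast hdet
  have hsab : (SignType.sign a : ℤ) * SignType.sign b = (SignType.sign a' : ℤ) * SignType.sign b' := by
    have h1 : SignType.sign (a * b) = SignType.sign (a' * b') := by
      rw [hP, sign_mul, sign_pos ht, one_mul]
    rw [sign_mul, sign_mul] at h1
    have := congrArg (fun s : SignType => (s : ℤ)) h1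
    simpa only [SignType.coe_mul] using this
  -- positive definiteness
  have hpos : (0 < a' ∧ 0 < b') ↔ (0 < a ∧ 0 < b) := by
    rw [← posDef_diagonal_two_iff, ← posDef_diagonal_two_iff]
    exact ⟨posDef_of_isCongruent h, posDef_of_isCongruent h.symm⟩
  have h2 : (SignType.sign a' = 1 ∧ SignType.sign b' = 1) ↔ (SignType.sign a = 1 ∧ SignType.sign b = 1) := by
    simpa only [sign_eq_one_iff] using hpos
  -- the sixteen sign patterns
  rcases sign_eq_one_or_neg_one a ha with hsa | hsa <;> rcases sign_eq_one_or_neg_one b hb with hsb | hsb <;>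
    rcases sign_eq_one_or_neg_one a' ha' with hsa' | hsa' <;>
    rcases sign_eq_one_or_neg_one b' hb' with hsb' | hsb' <;>
    rw [hsa, hsb, hsa', hsb'] at hsab <;> rw [hsa, hsb, hsa', hsb'] at h2 <;> rw [hsa, hsb, hsa', hsb'] <;>
    simp only [SignType.coe_one, SignType.coe_neg_one] at hsab ⊢ <;>
    first
    | decide
    | (exfalso; revert hsab; decide)
    | (exfalso; revert h2; decide)

end Complex

/-! ## Necessity over the CM field, and Theorem 2.2 (i) as an `iff` -/

section CMField

variable {K : Type*} [Field K] [NumberField K] [IsCMField K]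

/-- Congruence over `K` gives congruence over `ℂ` under every embedding (`φ ∘ star = conj ∘ φ`). -/
theorem isCongruent_map_of_isCongruent (φ : K →+* ℂ) {n : Type*} [Fintype n] [DecidableEq n]
    {H H' : Matrix n n K} (h : IsCongruent H H') : IsCongruent (H.map φ) (H'.map φ) :=
  isCongruent_map_of_star_comm φ (fun x => complexEmbedding_complexConj K φ x) h

/-- **Congruent ⇒ the same determinant class:** `det H' = z · star z · det H` with `z = det P ≠ 0`. -/
theorem exists_det_eq_mul_norm_of_isCongruent {n : Type*} [Fintype n] [DecidableEq n] {H H' : Matrix n n K}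
    (h : IsCongruent H H') : ∃ z : K, z ≠ 0 ∧ H'.det = z * star z * H.det := by
  obtain ⟨u, hu, hdet⟩ := h.exists_det_eq
  exact ⟨u, hu.ne_zero, by rw [hdet, mul_comm (star u) u]⟩

/-- **Congruent under `φ` ⇒ equal sign sums at `φ`** for totally real non-zero coefficients. -/
theorem sign_add_eq_of_isCongruent_map (φ : K →+* ℂ) {c₁ c₂ c₁' c₂' : K}
    (h₁ : star c₁ = c₁) (h₂ : star c₂ = c₂) (h₁' : star c₁' = c₁') (h₂' : star c₂' = c₂')
    (hc₁ : c₁ ≠ 0) (hc₂ : c₂ ≠ 0) (hc₁' : c₁' ≠ 0) (hc₂' : c₂' ≠ 0)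
    (h : IsCongruent ((diagonal ![c₁', c₂']).map φ) ((diagonal ![c₁, c₂]).map φ)) :
    (SignType.sign (φ c₁).re : ℤ) + SignType.sign (φ c₂).re =
      (SignType.sign (φ c₁').re : ℤ) + SignType.sign (φ c₂').re := by
  rw [map_diagonal_eq φ h₁' h₂', map_diagonal_eq φ h₁ h₂] at h
  exact sign_add_eq_of_isCongruent (re_ne_zero φ h₁ hc₁) (re_ne_zero φ h₂ hc₂) (re_ne_zero φ h₁' hc₁')
    (re_ne_zero φ h₂' hc₂') h

/-- **Theorem 2.2 (i) in Gram form as an `iff`, modulo the Hasse principle:** two invertible hermitian Gram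
matrices over `K` are congruent iff their determinants lie in the same class modulo norms and they are congruent
under every embedding `K → ℂ`. `⇐` is file 161's `isCongruent_of_det_eq_mul_norm` (the display); `⇒` needs nothing. -/
theorem isCongruent_iff_invariants {n : Type*} [Fintype n] [DecidableEq n] {H H' : Matrix n n K}
    (hH : H.IsHermitian) (hH' : H'.IsHermitian) (hdet : IsUnit H.det) (hdet' : IsUnit H'.det)
    (hLandherr : GrossBH2021_Thm3_1_uniqueness K n) :
    IsCongruent H H' ↔
      ((∃ z : K, z ≠ 0 ∧ H'.det = z * star z * H.det) ∧
        ∀ φ : K →+* ℂ, IsCongruent (H.map φ) (H'.map φ)) := by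
  constructor
  · intro h
    exact ⟨exists_det_eq_mul_norm_of_isCongruent h, fun φ => isCongruent_map_of_isCongruent φ h⟩
  · rintro ⟨⟨z, -, hz⟩, hreal⟩
    exact isCongruent_of_det_eq_mul_norm hH hH' hdet hdet' z hz hreal hLandherr

/-- **Theorem 2.2 (i) as an `iff` on the rank-2 diagonal forms of seat t6-p5's display:** for totally real non-zero
`c₁ c₂ c₁' c₂'`, an isometry `g` with `pairForm c₁' c₂' (g v) (g w) = pairForm c₁ c₂ v w` exists iff
`c₁ c₂ = c₁' c₂' · z z̄` for some `z ≠ 0` (same `d₀`) AND the sign sums agree under every `φ : K → ℂ` (same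
`{σ_v}`). `⇐` = file 161's display implication (the Hasse principle); `⇒` = the two necessity lemmas. -/
theorem exists_isometry_pairForm_iff (hLandherr : GrossBH2021_Thm3_1_uniqueness K (Fin 2))
    {c₁ c₂ c₁' c₂' : K} (h₁ : star c₁ = c₁) (h₂ : star c₂ = c₂) (h₁' : star c₁' = c₁') (h₂' : star c₂' = c₂')
    (hc₁ : c₁ ≠ 0) (hc₂ : c₂ ≠ 0) (hc₁' : c₁' ≠ 0) (hc₂' : c₂' ≠ 0) :
    (∃ g : (K × K) ≃ₗ[K] (K × K), ∀ v w, pairForm c₁' c₂' (g v) (g w) = pairForm c₁ c₂ v w) ↔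
      ((∃ z : K, z ≠ 0 ∧ c₁ * c₂ = c₁' * c₂' * (z * star z)) ∧
        ∀ φ : K →+* ℂ, (SignType.sign (φ c₁).re : ℤ) + SignType.sign (φ c₂).re =
          (SignType.sign (φ c₁').re : ℤ) + SignType.sign (φ c₂').re) := by
  constructor
  · intro hg
    have h := isCongruent_diagonal_of_exists_isometry_pairForm hg
    refine ⟨?_, fun φ => sign_add_eq_of_isCongruent_map φ h₁ h₂ h₁' h₂' hc₁ hc₂ hc₁' hc₂'
      (isCongruent_map_of_isCongruent φ h)⟩
    obtain ⟨z, hz, hdet⟩ := exists_det_eq_mul_norm_of_isCongruent h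
    refine ⟨z, hz, ?_⟩
    rw [det_diagonal, det_diagonal, Fin.prod_univ_two, Fin.prod_univ_two] at hdet
    simp only [Matrix.cons_val_zero, Matrix.cons_val_one] at hdet
    rw [hdet]
    ring
  · rintro ⟨hnorm, hsign⟩
    exact shimura2008_Thm2_2_i_of_grossBH2021 hLandherr c₁ c₂ c₁' c₂' h₁ h₂ h₁' h₂' hc₁ hc₂ hc₁' hc₂' hnorm hsign

end CMField

end Summit.Ventures.HodgeRepro2.T5LandherrInvariantsIff
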